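import Mathlib
import HarnessLib
import Summits.Langlands.Langlands.Theses.SkinnerWilesDefectOne
import Literature.NumberTheory.GaloisRepresentations.NearlyOrdinaryDeformationRing
import Literature.NumberTheory.GaloisRepresentations.NearlyOrdinaryDeformationRingProofs
import Literature.NumberTheory.Automorphic.POrdinaryHeckeAlgebraGL2
import Summits.Langlands.Langlands.Theorems.SkinnerWilesDefectOneProModularOfEisensteinSeedReducibleLocus
import Summits.Langlands.Langlands.Theorems.SkinnerWilesDefectOneProModularOfEisensteinSeedNicePrimeSupply
import Summits.Langlands.Langlands.Theorems.SkinnerWilesDefectOneReducibleOrdinaryProModularGenericEisensteinDefs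
import Summits.Langlands.Langlands.Theorems.SkinnerWilesDefectOneReducibleOrdinaryProModularGenericEisensteinRedIdealAux

/-!
# `Spec R_𝒟^red = V(I)` for the tree's universal nearly ordinary deformation ring, and the reduction of stub
# `stub_eisensteinDivisor` to three named facts: helper for line generic-eisenstein-rigidity (crux ReducibleOrdinaryProModular, stmt-Langlands-12919)

Route `SkinnerWilesDefectOne`, line lead's helper file (wave 1, stub-worker output integrated by the lead).  For a
residual datum `𝒟` with `ρ̄` upper triangular, scalar centralizer and distinguished above `p`, and ANY universal
nearly ordinary deformation ring `𝓡` of the tree's interface `NearlyOrdinaryDeformationRing`: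

* §1 `exists_swap_conj` (the swap frame); `residue_ρ_apply`, `isReducible_modPrime_closedPoint`,
  `closedPoint_mem_reducibleLocus` (the closed point is reducible), `redIdeal_le_maximalIdeal`, `redIdeal_ne_top`;
  the Skinner–Wiles NORMAL FRAME `exists_normalFrame` (diagonal `ρ(g₀)` with unit difference AND a unit lower-left
  entry — else `ρ̄` would be diagonal and have a non-scalar endomorphism); `exists_normalFrame_redIdeal_eq_span`
  (`I = (b_γ : γ)`), **`reducibleLocus_eq_zeroLocus_redIdeal` (`Z^red = V(I)`, SW99 §2.2)**,
  `mem_reducibleLocus_iff_redIdeal_le`, `mem_reducibleLocus_of_mem_minimalPrimes`;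
* §2 `exists_minimalPrimes_le_ringKrullDim_quotient` and the REDUCTION `stub_eisensteinDivisor_of_isPrincipal_of_dim`
  (registered by name): the conclusion of `stub_eisensteinDivisor` follows from the [SW] conjunction plus
  (F1) `redIdeal (det ρ_𝒟)` principal (Berger–Klosin regime), (F2) every component of `Spec R_𝒟` has dimension
  `≥ n + 1` (presentation bound, SW99 Prop. 2.4 transposed), (F3) every reducible prime has dimension `≤ n`
  (SW99 Lemma 2.7 transposed) — none of which is in the tree (the stub itself stays open: it is the line's
  Galois-side bet for `h_ll ≥ 2`).

The theorem `stub_eisensteinDivisor_auxReducibleLocus` is the second registered one-line wrapper (sub-goal of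
stmt-Langlands-12919) through which this helper file lands.

References: Skinner–Wiles, Publ. Math. IHÉS 89 (1999), §2.2 (Lemmas 2.7–2.8, Prop. 2.4); Bellaïche–Chenevier,
Astérisque 324 (2009), §1.5; Berger–Klosin, Math. Ann. 355 (2013), §5.2.
-/

set_option linter.dupNamespace false

namespace Summit.Langlands.Langlands.Cruxes.ReducibleOrdinaryProModular.GenericEisensteinRigidity

open Summit.Langlands.Langlands.Theses.SkinnerWilesDefectOne
open Literature.NumberTheory.Automorphic Literature.NumberTheory.Automorphic.BigHeckeGLn
open Literature.NumberTheory.GaloisRepresentations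
open NumberField IsDedekindDomain IsLocalRing Filter Field
open scoped MatrixGroups Matrix NumberField NNReal

noncomputable section

/-! ## §1 The reducible locus of `R_𝒟` is `V(I)` -/

section DeformationRing

variable {F : Type} [Field F] [NumberField F] {p : ℕ}
variable {𝒪 : Type} [CommRing 𝒪] {k : Type} [Field k] [Algebra 𝒪 k] {𝒟 : NearlyOrdinaryDatum F p 𝒪 k}
variable (𝓡 : NearlyOrdinaryDeformationRing.{0} 𝒟)

/-- `π` applied to an entry of `ρ_𝒟(γ)` is the corresponding entry of `ρ̄(γ)`. [folklore] -/
theorem residue_ρ_apply (γ : absoluteGaloisGroup F) (i j : Fin 2) :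
    (𝓡.π : 𝓡.R →+* k) ((𝓡.ρ γ).val i j) = (𝒟.residual γ).val i j := by
  have h := DFunLike.congr_fun 𝓡.isLift.residual_eq γ
  rw [MonoidHom.comp_apply] at h
  rw [← h]
  rfl

/-- If `ρ̄` is upper triangular in the standard basis then `ρ_𝒟 mod 𝔪_R` is upper triangular
(frame `P = 1`), in particular reducible. [cite: SkinnerWiles1999, §2.2] -/
theorem isReducible_modPrime_closedPoint (hup : ∀ γ, (𝒟.residual γ).val 1 0 = 0) :
    Deformation.IsReducible (𝓡.modPrime (IsLocalRing.closedPoint 𝓡.R)) := by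
  refine ⟨1, fun γ => ?_⟩
  rw [inv_one, one_mul, mul_one]
  change Ideal.Quotient.mk (maximalIdeal 𝓡.R) ((𝓡.ρ γ).val 1 0) = 0
  rw [Ideal.Quotient.eq_zero_iff_mem, ← 𝓡.ker_π, RingHom.mem_ker, RingHom.coe_coe]
  have h := residue_ρ_apply 𝓡 γ 1 0
  rw [RingHom.coe_coe] at h
  rw [h, hup γ]

/-- **The closed point is reducible**: `𝔪_R ∈ Z^red` when `ρ̄` is upper triangular.
[cite: SkinnerWiles1999, §2.2] -/
theorem closedPoint_mem_reducibleLocus (hup : ∀ γ, (𝒟.residual γ).val 1 0 = 0) :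
    IsLocalRing.closedPoint 𝓡.R ∈ 𝓡.reducibleLocus :=
  𝓡.mem_reducibleLocus_of_isReducible_modPrime _ (isReducible_modPrime_closedPoint 𝓡 hup)

/-- **`I ⊆ 𝔪_R`**: the reducibility ideal of `det ρ_𝒟` is a proper ideal when `ρ̄` is upper
triangular (`det ρ_𝒟 mod 𝔪 = χ̄₁ ⊕ χ̄₂`). [cite: SkinnerWiles1999, §2.2] -/
theorem redIdeal_le_maximalIdeal (hup : ∀ γ, (𝒟.residual γ).val 1 0 = 0) :
    redIdeal (PseudoRep2.ofRep 𝓡.ρ) ≤ maximalIdeal 𝓡.R :=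
  redIdeal_le_of_isReducible 𝓡.ρ _ (isReducible_modPrime_closedPoint 𝓡 hup)

/-- … hence `I ≠ ⊤` and `I` has minimal primes. [folklore] -/
theorem redIdeal_ne_top (hup : ∀ γ, (𝒟.residual γ).val 1 0 = 0) :
    redIdeal (PseudoRep2.ofRep 𝓡.ρ) ≠ ⊤ := fun h =>
  (maximalIdeal.isMaximal 𝓡.R).ne_top (top_le_iff.mp (h ▸ redIdeal_le_maximalIdeal 𝓡 hup))

/-- **Skinner–Wiles normal frame.**  If `ρ̄` has scalar centralizer (e.g. is a NON-SPLIT extension of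
distinct characters) and `𝒟` is distinguished at some `v ∣ p`, there are `D ∈ GL₂(R_𝒟)` and
`g₀, γ₁ ∈ Γ_F` with `D⁻¹ ρ_𝒟(g₀) D = diag(α, δ)`, `α − δ ∈ R_𝒟ˣ`, and `(D⁻¹ ρ_𝒟(γ₁) D)₁₀ ∈ R_𝒟ˣ`
(a unit LOWER-LEFT entry): in a diagonal frame not all off-diagonal entries can lie in `𝔪_R`, for
then `ρ̄` would be diagonal in the residual frame and `D̄ diag(1,0) D̄⁻¹` a non-scalar endomorphism;
a unit upper-right entry is moved to the lower-left corner by the swap frame.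
[cite: SkinnerWiles1999, §2.1–2.2] -/
theorem exists_normalFrame (hsc : 𝒟.HasScalarCentralizer) {v : HeightOneSpectrum (𝓞 F)}
    (hv : (p : 𝓞 F) ∈ v.asIdeal) (hd : 𝒟.IsDistinguishedAt v) :
    ∃ (D : GL (Fin 2) 𝓡.R) (g₀ γ₁ : absoluteGaloisGroup F),
      (D⁻¹ * 𝓡.ρ g₀ * D).val 0 1 = 0 ∧ (D⁻¹ * 𝓡.ρ g₀ * D).val 1 0 = 0 ∧
      IsUnit ((D⁻¹ * 𝓡.ρ g₀ * D).val 0 0 - (D⁻¹ * 𝓡.ρ g₀ * D).val 1 1) ∧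
      IsUnit ((D⁻¹ * 𝓡.ρ γ₁ * D).val 1 0) := by
  obtain ⟨D, g₀, h01, h10, hunit⟩ := Theorems.exists_diagonalFrame 𝓡 hv hd
  -- not all off-diagonal entries are in `𝔪_R`
  have key : (∃ γ, IsUnit ((D⁻¹ * 𝓡.ρ γ * D).val 1 0)) ∨ ∃ γ, IsUnit ((D⁻¹ * 𝓡.ρ γ * D).val 0 1) := by
    by_cases hc : ∃ γ, IsUnit ((D⁻¹ * 𝓡.ρ γ * D).val 1 0)
    · exact Or.inl hc
    by_cases hb : ∃ γ, IsUnit ((D⁻¹ * 𝓡.ρ γ * D).val 0 1)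
    · exact Or.inr hb
    exfalso
    simp only [not_exists] at hc hb
    set π : 𝓡.R →+* k := (𝓡.π : 𝓡.R →+* k) with hπ
    set Dbar : GL (Fin 2) k := Matrix.GeneralLinearGroup.map π D with hDbar
    -- residually `D̄⁻¹ ρ̄ D̄` is diagonal
    have hres : ∀ γ, Matrix.GeneralLinearGroup.map π (D⁻¹ * 𝓡.ρ γ * D) =
        Dbar⁻¹ * 𝒟.residual γ * Dbar := fun γ => by
      have h := DFunLike.congr_fun 𝓡.isLift.residual_eq γ
      rw [MonoidHom.comp_apply] at h
      rw [map_mul, map_mul, map_inv, h]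
    have hmem : ∀ r : 𝓡.R, ¬ IsUnit r → π r = 0 := fun r hr => by
      have : r ∈ maximalIdeal 𝓡.R := hr
      rwa [← 𝓡.ker_π, RingHom.mem_ker] at this
    have hdiag : ∀ γ, (Dbar⁻¹ * 𝒟.residual γ * Dbar).val 1 0 = 0 ∧
        (Dbar⁻¹ * 𝒟.residual γ * Dbar).val 0 1 = 0 := fun γ => by
      rw [← hres γ]
      exact ⟨hmem _ (hc γ), hmem _ (hb γ)⟩
    -- the non-scalar endomorphism `D̄ E D̄⁻¹`, `E = diag(1, 0)`
    set E : Matrix (Fin 2) (Fin 2) k := !![1, 0; 0, 0] with hE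
    have hEN : ∀ N : Matrix (Fin 2) (Fin 2) k, N 1 0 = 0 → N 0 1 = 0 → E * N = N * E :=
      fun N h1 h2 => by
        ext i j
        fin_cases i <;> fin_cases j <;> simp [Matrix.mul_apply, Fin.sum_univ_two, hE, h1, h2]
    have hEcomm : ∀ γ, E * (Dbar⁻¹ * 𝒟.residual γ * Dbar).val =
        (Dbar⁻¹ * 𝒟.residual γ * Dbar).val * E := fun γ =>
      hEN _ (hdiag γ).1 (hdiag γ).2
    have hinv : (Dbar⁻¹).val * Dbar.val = 1 := by
      rw [← Units.val_mul, inv_mul_cancel, Units.val_one]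
    have hρ : ∀ γ, (𝒟.residual γ).val =
        Dbar.val * (Dbar⁻¹ * 𝒟.residual γ * Dbar).val * (Dbar⁻¹).val := fun γ => by
      rw [← Units.val_mul, ← Units.val_mul]
      congr 1
      group
    set M : Matrix (Fin 2) (Fin 2) k := Dbar.val * E * (Dbar⁻¹).val with hM
    have hMcomm : ∀ γ, M * (𝒟.residual γ).val = (𝒟.residual γ).val * M := fun γ => by
      calc M * (𝒟.residual γ).val
          = Dbar.val * E * ((Dbar⁻¹).val * Dbar.val) * (Dbar⁻¹ * 𝒟.residual γ * Dbar).val *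
              (Dbar⁻¹).val := by rw [hρ γ, hM]; simp only [mul_assoc]
        _ = Dbar.val * (E * (Dbar⁻¹ * 𝒟.residual γ * Dbar).val) * (Dbar⁻¹).val := by
              rw [hinv, mul_one]; simp only [mul_assoc]
        _ = Dbar.val * ((Dbar⁻¹ * 𝒟.residual γ * Dbar).val * E) * (Dbar⁻¹).val := by rw [hEcomm]
        _ = Dbar.val * (Dbar⁻¹ * 𝒟.residual γ * Dbar).val * ((Dbar⁻¹).val * Dbar.val) * E *
              (Dbar⁻¹).val := by rw [hinv, mul_one]; simp only [mul_assoc]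
        _ = (𝒟.residual γ).val * M := by rw [hρ γ, hM]; simp only [mul_assoc]
    obtain ⟨c, hc'⟩ := hsc M hMcomm
    -- then `E = c • 1`, absurd
    have hE' : E = c • (1 : Matrix (Fin 2) (Fin 2) k) := by
      calc E = ((Dbar⁻¹).val * Dbar.val) * E * ((Dbar⁻¹).val * Dbar.val) := by
              rw [hinv, one_mul, mul_one]
        _ = (Dbar⁻¹).val * M * Dbar.val := by rw [hM]; simp only [mul_assoc]
        _ = c • (1 : Matrix (Fin 2) (Fin 2) k) := by
              rw [hc', Matrix.mul_smul, Matrix.smul_mul, mul_one, hinv]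
    have h00 := congrFun (congrFun hE' 0) 0
    have h11 := congrFun (congrFun hE' 1) 1
    simp [hE] at h00 h11
    exact one_ne_zero (h00.trans h11.symm)
  rcases key with ⟨γ₁, hγ₁⟩ | ⟨γ₁, hγ₁⟩
  · exact ⟨D, g₀, γ₁, h01, h10, hunit, hγ₁⟩
  · -- swap the frame
    obtain ⟨w, hw⟩ := exists_swap_conj (A := 𝓡.R)
    have hconj : ∀ γ, (D * w)⁻¹ * 𝓡.ρ γ * (D * w) = w⁻¹ * (D⁻¹ * 𝓡.ρ γ * D) * w := fun γ => by
      group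
    refine ⟨D * w, g₀, γ₁, ?_, ?_, ?_, ?_⟩
    · rw [hconj, (hw _).2.1, h10]
    · rw [hconj, (hw _).2.2.1, h01]
    · rw [hconj, (hw _).1, (hw _).2.2.2, ← neg_sub]
      exact hunit.neg
    · rw [hconj, (hw _).2.2.1]
      exact hγ₁

variable [Fact p.Prime]

/-- **`Spec R_𝒟^red = V(I)` (Skinner–Wiles).**  For a datum with scalar centralizer, distinguished above
`p`: in a normal frame the reducibility ideal `I = redIdeal (det ρ_𝒟)` is generated by the upper-right
entries `b_γ` (`I = (b_γ c_γ')` by Bellaïche–Chenevier and some `c_γ₁` is a unit) and the reducible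
locus (primes `𝔮` with `ρ_𝒟 mod 𝔮` reducible over `Frac(R/𝔮)`) is exactly `V(I)`.
[cite: SkinnerWiles1999, §2.2] -/
theorem exists_normalFrame_redIdeal_eq_span (hsc : 𝒟.HasScalarCentralizer)
    (hdist : ∀ v : HeightOneSpectrum (𝓞 F), (p : 𝓞 F) ∈ v.asIdeal → 𝒟.IsDistinguishedAt v) :
    ∃ D : GL (Fin 2) 𝓡.R,
      redIdeal (PseudoRep2.ofRep 𝓡.ρ) = Ideal.span (Set.range fun γ => (D⁻¹ * 𝓡.ρ γ * D).val 0 1) ∧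
      𝓡.reducibleLocus = PrimeSpectrum.zeroLocus (Set.range fun γ => (D⁻¹ * 𝓡.ρ γ * D).val 0 1) := by
  obtain ⟨v, hv⟩ := NearlyOrdinaryDatum.exists_heightOneSpectrum_mem (F := F) (Fact.out : p.Prime)
  obtain ⟨D, g₀, γ₁, h01, h10, hunit, hγ₁⟩ := exists_normalFrame 𝓡 hsc hv (hdist v hv)
  refine ⟨D, ?_, ?_⟩
  · rw [redIdeal_ofRep_eq_span_frame 𝓡.ρ D g₀ h01 h10 hunit]
    apply le_antisymm
    · rw [Ideal.span_le]
      rintro _ ⟨⟨γ, γ'⟩, rfl⟩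
      exact Ideal.mul_mem_right _ _ (Ideal.subset_span ⟨γ, rfl⟩)
    · rw [Ideal.span_le]
      rintro _ ⟨γ, rfl⟩
      obtain ⟨u, hu⟩ := hγ₁
      have h : (D⁻¹ * 𝓡.ρ γ * D).val 0 1 =
          ((D⁻¹ * 𝓡.ρ γ * D).val 0 1 * (D⁻¹ * 𝓡.ρ γ₁ * D).val 1 0) * ↑u⁻¹ := by
        rw [← hu, Units.mul_inv_cancel_right]
      dsimp only
      rw [SetLike.mem_coe, h]
      exact Ideal.mul_mem_right _ _ (Ideal.subset_span ⟨(γ, γ₁), rfl⟩)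
  · rw [Theorems.reducibleLocus_eq_zeroLocus_union 𝓡 D g₀ h01 h10 hunit, Set.union_eq_right]
    intro 𝔮 h𝔮
    exfalso
    rw [PrimeSpectrum.mem_zeroLocus, Set.range_subset_iff] at h𝔮
    exact 𝔮.isPrime.ne_top (Ideal.eq_top_of_isUnit_mem _ (h𝔮 γ₁) hγ₁)

/-- **`Z^red = V(I)`.** [cite: SkinnerWiles1999, §2.2] -/
theorem reducibleLocus_eq_zeroLocus_redIdeal (hsc : 𝒟.HasScalarCentralizer)
    (hdist : ∀ v : HeightOneSpectrum (𝓞 F), (p : 𝓞 F) ∈ v.asIdeal → 𝒟.IsDistinguishedAt v) :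
    𝓡.reducibleLocus = PrimeSpectrum.zeroLocus (redIdeal (PseudoRep2.ofRep 𝓡.ρ) : Set 𝓡.R) := by
  obtain ⟨D, hI, hZ⟩ := exists_normalFrame_redIdeal_eq_span 𝓡 hsc hdist
  rw [hZ, hI, PrimeSpectrum.zeroLocus_span]

/-- `𝔮 ∈ Z^red ↔ I ≤ 𝔮`. [cite: SkinnerWiles1999, §2.2] -/
theorem mem_reducibleLocus_iff_redIdeal_le (hsc : 𝒟.HasScalarCentralizer)
    (hdist : ∀ v : HeightOneSpectrum (𝓞 F), (p : 𝓞 F) ∈ v.asIdeal → 𝒟.IsDistinguishedAt v)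
    (𝔮 : PrimeSpectrum 𝓡.R) :
    𝔮 ∈ 𝓡.reducibleLocus ↔ redIdeal (PseudoRep2.ofRep 𝓡.ρ) ≤ 𝔮.asIdeal := by
  rw [reducibleLocus_eq_zeroLocus_redIdeal 𝓡 hsc hdist, PrimeSpectrum.mem_zeroLocus]
  rfl

/-- In particular every minimal prime OVER `I` is a (generic) point of the reducible locus.
[cite: SkinnerWiles1999, §2.2] -/
theorem mem_reducibleLocus_of_mem_minimalPrimes (hsc : 𝒟.HasScalarCentralizer)
    (hdist : ∀ v : HeightOneSpectrum (𝓞 F), (p : 𝓞 F) ∈ v.asIdeal → 𝒟.IsDistinguishedAt v)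
    (η : PrimeSpectrum 𝓡.R) (hη : η.asIdeal ∈ (redIdeal (PseudoRep2.ofRep 𝓡.ρ)).minimalPrimes) :
    η ∈ 𝓡.reducibleLocus :=
  (mem_reducibleLocus_iff_redIdeal_le 𝓡 hsc hdist η).mpr hη.1.2

end DeformationRing

/-! ## §2 Reduction of the stub to three named facts -/

section Reduction

/-- **Lowering a chain to a minimal prime.**  If `dim R/J ≥ n` then some MINIMAL prime `P` of `J`
has `dim R/P ≥ n` (lower the bottom of a chain of length `n` in `V(J)` to a minimal prime of `J`).
[folklore] -/
theorem exists_minimalPrimes_le_ringKrullDim_quotient {R : Type*} [CommRing R] (J : Ideal R) (n : ℕ)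
    (h : (n : WithBot ℕ∞) ≤ ringKrullDim (R ⧸ J)) :
    ∃ P ∈ J.minimalPrimes, (n : WithBot ℕ∞) ≤ ringKrullDim (R ⧸ P) := by
  rw [ringKrullDim_quotient, Order.le_krullDim_iff] at h
  obtain ⟨l, hl⟩ := h
  have hhead : J ≤ (l 0).1.asIdeal := fun r hr => (PrimeSpectrum.mem_zeroLocus _ _).mp (l 0).2 hr
  obtain ⟨P, hP, hPle⟩ := Ideal.exists_minimalPrimes_le hhead
  refine ⟨P, hP, ?_⟩
  rw [ringKrullDim_quotient, Order.le_krullDim_iff]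
  have hmem : ∀ i, (l i).1 ∈ PrimeSpectrum.zeroLocus (R := R) (P : Set R) := fun i => by
    rw [PrimeSpectrum.mem_zeroLocus]
    intro r hr
    have hmono : (l 0).1 ≤ (l i).1 := l.strictMono.monotone (Fin.zero_le i)
    exact ((PrimeSpectrum.asIdeal_le_asIdeal _ _).mpr hmono) (hPle hr)
  exact ⟨⟨l.length, fun i => ⟨(l i).1, hmem i⟩, fun i => l.step i⟩, hl⟩

/-- **The stub, reduced to three named facts.**  For an SW-admissible oriented datum (the [SW]
conjunction, of which only scalar centralizer, distinguishedness above `p` and upper-triangularity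
of `ρ̄` are used) the conclusion of `stub_eisensteinDivisor` follows from
(F1) the reducibility ideal `I = redIdeal (det ρ_𝒟)` is PRINCIPAL (Berger–Klosin: when
`dim_k H¹_Σ(F, k(χ̄₂χ̄₁⁻¹)) = 1`), (F2) every irreducible component of `Spec R_𝒟` has dimension
`≥ n + 1` (presentation bound, Skinner–Wiles Prop. 2.4 transposed) and (F3) every prime of the
reducible locus has dimension `≤ n` (Skinner–Wiles Lemma 2.7 transposed; the sibling line's
`SmallReducibleLocus` with `n = 3`).  Proof: `I = (x)`; for ANY minimal `𝔮 ⊆ 𝔭`, `x ∉ 𝔮`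
(`V(I) = Z^red ∌ 𝔭`), `dim R/(𝔮, x) ≥ dim R/𝔮 − 1 ≥ n` (Krull), so some minimal prime `η` of `(𝔮, x)`
has `dim R/η ≥ n`; a prime `P ∋ x` strictly below `η` would be reducible of dimension `≥ n + 1`,
contradicting (F3), so `η` is minimal over `(x) = I`; `I·R_η = (x)` is principal.
[cite: SkinnerWiles1999, §2.2 Lemmas 2.7–2.8 and Prop. 2.4] [cite: BergerKlosin2012, §5.2] -/
theorem stub_eisensteinDivisor_of_isPrincipal_of_dim : ∀ (F : Type) [Field F] [NumberField F]
    (p : ℕ) [Fact p.Prime]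
    (𝒪 : Type) [CommRing 𝒪] [IsLocalRing 𝒪] [IsNoetherianRing 𝒪] [IsAdicComplete (maximalIdeal 𝒪) 𝒪]
    (k : Type) [Field k] [Finite k] [CharP k p] [Algebra 𝒪 k]
    (𝒟 : NearlyOrdinaryDatum F p 𝒪 k) (𝓡 : NearlyOrdinaryDeformationRing.{0} 𝒟),
    (IsTotallyComplex F ∧ Module.finrank ℚ F = 2 ∧ p ≠ 2 ∧ IsDomain 𝒪 ∧ CharZero 𝒪 ∧
      𝒟.HasScalarCentralizer ∧
      (∀ v : HeightOneSpectrum (𝓞 F), (p : 𝓞 F) ∈ v.asIdeal → 𝒟.IsDistinguishedAt v) ∧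
      (∀ γ, (𝒟.residual γ).val 1 0 = 0) ∧
      (∀ v : HeightOneSpectrum (𝓞 F), (p : 𝓞 F) ∈ v.asIdeal → (𝒟.frame v).val 1 0 ≠ 0)) →
    (redIdeal (PseudoRep2.ofRep 𝓡.ρ)).IsPrincipal →
    ∀ n : ℕ, (∀ 𝔮 ∈ minimalPrimes 𝓡.R, ((n + 1 : ℕ) : WithBot ℕ∞) ≤ ringKrullDim (𝓡.R ⧸ 𝔮)) →
    (∀ P ∈ 𝓡.reducibleLocus, ringKrullDim (𝓡.R ⧸ P.asIdeal) ≤ n) →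
    ∀ 𝔭 : PrimeSpectrum 𝓡.R, 𝔭 ∉ 𝓡.reducibleLocus →
    ∃ 𝔮 ∈ minimalPrimes 𝓡.R, 𝔮 ≤ 𝔭.asIdeal ∧
      ∃ η : PrimeSpectrum 𝓡.R, η ∈ 𝓡.reducibleLocus ∧ 𝔮 ≤ η.asIdeal ∧
        η.asIdeal ∈ (redIdeal (PseudoRep2.ofRep 𝓡.ρ)).minimalPrimes ∧
        (Ideal.map (algebraMap 𝓡.R (Localization.AtPrime η.asIdeal))
          (redIdeal (PseudoRep2.ofRep 𝓡.ρ))).IsPrincipal := by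
  intro F _ _ p _ 𝒪 _ _ _ _ k _ _ _ _ 𝒟 𝓡 hSW hI n hbig hsmall 𝔭 h𝔭
  obtain ⟨-, -, -, -, -, hsc, hdist, hup, -⟩ := hSW
  have hZ := mem_reducibleLocus_iff_redIdeal_le 𝓡 hsc hdist
  obtain ⟨x, hx⟩ := hI
  have hxI : redIdeal (PseudoRep2.ofRep 𝓡.ρ) = Ideal.span {x} := hx
  -- any minimal prime below `𝔭`
  obtain ⟨𝔮, h𝔮min, h𝔮𝔭⟩ :=
    Ideal.exists_minimalPrimes_le (show (⊥ : Ideal 𝓡.R) ≤ 𝔭.asIdeal from bot_le)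
  haveI h𝔮p : 𝔮.IsPrime := h𝔮min.1.1
  refine ⟨𝔮, h𝔮min, h𝔮𝔭, ?_⟩
  -- `x ∉ 𝔮`, `x ∈ 𝔪`
  have hx𝔮 : x ∉ 𝔮 := fun h => h𝔭 ((hZ 𝔭).mpr (by
    rw [hxI, Ideal.span_singleton_le_iff_mem]; exact h𝔮𝔭 h))
  have hx𝔪 : x ∈ maximalIdeal 𝓡.R := by
    have h := redIdeal_le_maximalIdeal 𝓡 hup
    rw [hxI, Ideal.span_singleton_le_iff_mem] at h
    exact h
  have h𝔮𝔪 : 𝔮 ≤ maximalIdeal 𝓡.R := IsLocalRing.le_maximalIdeal h𝔮p.ne_top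
  -- the local noetherian domain `A = R/𝔮` and `x̄ ∈ 𝔪_A`
  haveI : IsLocalRing (𝓡.R ⧸ 𝔮) :=
    IsLocalRing.of_surjective' (Ideal.Quotient.mk 𝔮) Ideal.Quotient.mk_surjective
  have hxb : Ideal.Quotient.mk 𝔮 x ∈ maximalIdeal (𝓡.R ⧸ 𝔮) := by
    rw [IsLocalRing.mem_maximalIdeal, mem_nonunits_iff]
    intro hu
    obtain ⟨y', hy'⟩ := hu.exists_right_inv
    obtain ⟨y, rfl⟩ := Ideal.Quotient.mk_surjective y'
    rw [← map_mul, ← (Ideal.Quotient.mk 𝔮).map_one, Ideal.Quotient.eq] at hy'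
    have h1 : (1 : 𝓡.R) ∈ maximalIdeal 𝓡.R := by
      have := sub_mem (Ideal.mul_mem_right y _ hx𝔪) (h𝔮𝔪 hy')
      rwa [sub_sub_cancel] at this
    exact (maximalIdeal.isMaximal 𝓡.R).ne_top (Ideal.eq_top_of_isUnit_mem _ h1 isUnit_one)
  -- Krull: `dim A/(x̄) ≥ dim A − 1 ≥ n`
  haveI : Nontrivial ((𝓡.R ⧸ 𝔮) ⧸ Ideal.span {Ideal.Quotient.mk 𝔮 x}) :=
    Ideal.Quotient.nontrivial_iff.mpr (Ideal.span_singleton_ne_top hxb)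
  haveI : IsLocalRing ((𝓡.R ⧸ 𝔮) ⧸ Ideal.span {Ideal.Quotient.mk 𝔮 x}) :=
    IsLocalRing.of_surjective' (Ideal.Quotient.mk _) Ideal.Quotient.mk_surjective
  obtain ⟨dA, hdA⟩ := Literature.AlgebraicGeometry.Motives.exists_ringKrullDim_eq_nat (𝓡.R ⧸ 𝔮)
  obtain ⟨m, hm⟩ := Literature.AlgebraicGeometry.Motives.exists_ringKrullDim_eq_nat
    ((𝓡.R ⧸ 𝔮) ⧸ Ideal.span {Ideal.Quotient.mk 𝔮 x})
  have hdimA : n + 1 ≤ dA := by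
    have h := hbig 𝔮 h𝔮min
    rw [hdA] at h
    exact_mod_cast h
  have hm' : dA ≤ m + 1 := by
    have h1 := Ideal.height_le_ringKrullDim_quotient_add_one hxb
    rw [IsLocalRing.maximalIdeal_height_eq_ringKrullDim, hdA, hm] at h1
    exact_mod_cast h1
  have hnm : n ≤ m := by omega
  -- transport to `R/(𝔮, x)`
  have hmap : (Ideal.span {x}).map (Ideal.Quotient.mk 𝔮) = Ideal.span {Ideal.Quotient.mk 𝔮 x} := by
    rw [Ideal.map_span, Set.image_singleton]
  have hJdim : (n : WithBot ℕ∞) ≤ ringKrullDim (𝓡.R ⧸ (𝔮 ⊔ Ideal.span {x})) := by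
    rw [← ringKrullDim_eq_of_ringEquiv (DoubleQuot.quotQuotEquivQuotSup 𝔮 (Ideal.span {x})),
      ringKrullDim_eq_of_ringEquiv (Ideal.quotEquivOfEq hmap), hm]
    exact_mod_cast hnm
  -- a minimal prime `η` of `(𝔮, x)` of dimension `≥ n`
  obtain ⟨η, hηmin, hηdim⟩ := exists_minimalPrimes_le_ringKrullDim_quotient _ n hJdim
  haveI hηp : η.IsPrime := hηmin.1.1
  have h𝔮η : 𝔮 ≤ η := le_sup_left.trans hηmin.1.2
  have hxη : x ∈ η := hηmin.1.2 (Ideal.mem_sup_right (Ideal.mem_span_singleton_self x))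
  have hIη : redIdeal (PseudoRep2.ofRep 𝓡.ρ) ≤ η := by
    rw [hxI, Ideal.span_singleton_le_iff_mem]
    exact hxη
  refine ⟨⟨η, hηp⟩, (hZ ⟨η, hηp⟩).mpr hIη, h𝔮η, ⟨⟨hηp, hIη⟩, ?_⟩, ?_⟩
  · -- minimality over `I`: a reducible prime strictly below `η` would have dimension `≥ n + 1`
    rintro P ⟨hP, hIP⟩ hPη
    rcases eq_or_lt_of_le hPη with h | h
    · exact h.symm.le
    · exfalso
      haveI := hP
      have h1 := Theorems.ringKrullDim_quotient_add_one_le_of_lt (R := 𝓡.R) h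
      have h2 := hsmall ⟨P, hP⟩ ((hZ ⟨P, hP⟩).mpr hIP)
      have h3 : (n : WithBot ℕ∞) + 1 ≤ n :=
        ((add_le_add hηdim (le_refl (1 : WithBot ℕ∞))).trans h1).trans h2
      have h4 : n + 1 ≤ n := by exact_mod_cast h3
      omega
  · -- `I R_η = (x)` is principal
    rw [hxI, Ideal.map_span, Set.image_singleton]
    exact ⟨⟨algebraMap 𝓡.R (Localization.AtPrime η) x, rfl⟩⟩

end Reduction

/-! ## §3 Registered wrapper -/

/-- **Registered wrapper** (sub-goal `stub_eisensteinDivisor_auxReducibleLocus` of stmt-Langlands-12919):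
`Spec R_𝒟^red = V(redIdeal (det ρ_𝒟))` for every universal nearly ordinary deformation ring of a datum with scalar
centralizer, distinguished above `p`. [cite: SkinnerWiles1999, §2.2] -/
theorem stub_eisensteinDivisor_auxReducibleLocus :
    ∀ (F : Type) [Field F] [NumberField F] (p : ℕ) [Fact p.Prime] (𝒪 : Type) [CommRing 𝒪]
      (k : Type) [Field k] [Algebra 𝒪 k] (𝒟 : NearlyOrdinaryDatum F p 𝒪 k)
      (𝓡 : NearlyOrdinaryDeformationRing.{0} 𝒟),
      𝒟.HasScalarCentralizer →
      (∀ v : HeightOneSpectrum (𝓞 F), (p : 𝓞 F) ∈ v.asIdeal → 𝒟.IsDistinguishedAt v) →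
      𝓡.reducibleLocus = PrimeSpectrum.zeroLocus (redIdeal (PseudoRep2.ofRep 𝓡.ρ) : Set 𝓡.R) :=
  fun _ _ _ _ _ _ _ _ _ _ _ 𝓡 hsc hdist => reducibleLocus_eq_zeroLocus_redIdeal 𝓡 hsc hdist

end

end Summit.Langlands.Langlands.Cruxes.ReducibleOrdinaryProModular.GenericEisensteinRigidity
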